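import Literature.MathematicalPhysics.QuantumFieldTheory.Balaban1983to89.UnitaryModel

/-!
# Bałaban's renormalization group for 4-d lattice Yang–Mills — the two matrix norms of B7 §A and their inequalities (`MatrixNorms`)

CITATION HEADER (lean-in-tree rule 2026-08-18). Companion to `Setup` / `UnitaryModel` (same series, audit cell `pub-balaban`,
unit b2b-balaban-f1). T. Bałaban, *Averaging operations for lattice gauge theories*, Comm. Math. Phys. **98** 17–51 (1985)
[Balaban1985Averaging] §A pp. 20–21: (17) p. 20 — the scalar product `⟨X, Y⟩ = tr X*Y` on `M_N(ℂ)` with the NORMALIZED trace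
`tr X = (1/N) Σ_j X_jj`; p. 21 (text after (18)) — "for a matrix `X` the norm is given by `‖X‖² = tr X*X`" (the `L²` norm, i.e. the
normalized Hilbert–Schmidt norm); (19) p. 21 — "another norm for matrices. It is the operator norm given by `|X| = sup |Xψ|`,
`|ψ| = 1`, `|ψ|² = Σ_j |ψ_j|²`" on `ℂᴺ`; (20) p. 21 — "We have the following inequalities for the norms introduced:
`|tr X| ≤ |X|, ‖X‖ ≤ |X|, |X| ≤ √N ‖X‖, |XY| ≤ |X| |Y|, ‖XY‖ ≤ ‖X‖ ‖Y‖`."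
T. Bałaban, *Renormalization group approach to lattice gauge field theories. I*, Comm. Math. Phys. **109** 249–301 (1987)
[Balaban1987RG1] (0.2) p. 252 (normalized trace, `tr 1 = 1`) and (0.14) p. 254: "exponential gauge fixing functions,
`exp[-(1/2α)|U(y,x) - 1|²] = exp[-(1/α)[1 - Re tr U(y,x)]]`."
WHAT IS REPRODUCED: no theorem of the series. The definitions (17), (19) and the list of inequalities (20) of
[Balaban1985Averaging], kernel-checked for complex `N × N` matrices over an arbitrary finite index type `n` (`N = Fintype.card n`):
`|X|` := Mathlib's `L²`-operator norm `‖X‖` (scope `Matrix.Norms.L2Operator`; the norm behind `UnitaryModel.opDist1` and the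
`dist1` of every concrete `GaugeGroup` instance of the cell), `tr` := `ntr`, `‖X‖` := `nhsNorm X` with
`‖X‖² = nhsNormSq X = (1/N) Σ_ij |X_ij|² = tr X*X` (`nhsInner_self`; the prefix `n` = normalized, as in `UnitaryModel.nReTr`;
the tree's UNnormalized `Literature.Computability.QuantumComplexity.hsNormSq A = Σ_ij |A_ij|²` is `N · nhsNormSq A`,
`card_mul_nhsNormSq`, and is deliberately not imported: the cell's import cone stays Mathlib + the cell); and the matrix
identity behind (0.14).
FINDINGS OF THE AUDIT (cell DIVERGENCE.md F13, F14; GAPS.md G-f1-1), both certified in this file: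
(a) the LAST inequality of (20), `‖XY‖ ≤ ‖X‖ ‖Y‖`, is FALSE for the norm `‖·‖` defined on p. 21 from the normalized trace (17):
`nhsNorm_mul_not_submultiplicative` (`X = Y = diag(1, 0) ∈ M₂(ℂ)`: `‖XY‖ = ‖X‖ = 1/√2 > 1/2 = ‖X‖ ‖Y‖`). What holds, and is
proved here, is `‖XY‖ ≤ |X| ‖Y‖`, `‖XY‖ ≤ ‖X‖ |Y|` and `‖XY‖ ≤ √N ‖X‖ ‖Y‖` (submultiplicativity of the UNnormalized
Hilbert–Schmidt norm `√N ‖·‖`); the other four inequalities of (20) hold as printed.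
(b) (0.14) of [Balaban1987RG1] is the identity `‖U - 1‖² = 2 [1 - Re tr U]` (all unitary `U`, all `N`;
`nhsNormSq_sub_one_of_mem_unitaryGroup`) for the `L²` norm `‖·‖` of [Balaban1985Averaging] p. 21, although it is printed with the
bars `|·|` which (19) and the same paragraph of [Balaban1987RG1] (small-field condition `|U(∂p) - 1| < ε₀`) use for the OPERATOR
norm. Read with the operator norm, (0.14) holds on `SU(2)` (`opDist1_sq_eq_of_mem_specialUnitaryGroup_two`, via Cayley–Hamilton)
and fails on `U(2)` and on `SU(3)` (`exists_unitaryGroup_two_opDist1_sq_ne`: `diag(-1, 1)`, `4 ≠ 2`;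
`exists_specialUnitaryGroup_three_opDist1_sq_ne`: `diag(-1, -1, 1)`, `4 ≠ 8/3`); in general only
`2 [1 - Re tr U] ≤ |U - 1|² ≤ 2N [1 - Re tr U]` (`two_mul_one_sub_nReTr_le_opDist1_sq`, `opDist1_sq_le_card_mul`).
Neither finding touches a proof of the series ((0.14) motivates the gauge-fixing density, whose right-hand side is what (0.15) ff.
use; (20) is quoted, not used, at the level of this cell); they are recorded so that no module of the cell types (0.14) with
`opDist1` / `dist1`, or uses submultiplicativity of `‖·‖`. Value = typed vocabulary + kernel certificate, not summit progress.
-/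

open scoped BigOperators Matrix ComplexConjugate

namespace Literature.MathematicalPhysics.QuantumFieldTheory.Balaban1983to89

namespace MatrixNorms

open scoped Matrix.Norms.L2Operator
open UnitaryModel

noncomputable section

/-! ## 1. The normalized trace and the `L²` (normalized Hilbert–Schmidt) norm — B7 (17) p. 20, p. 21 -/

section Trace

variable {n : Type*} [Fintype n]

/-- B7 (17): the normalized (complex) trace `tr X = (1/N) Σ_j X_jj`, `N = Fintype.card n`; its real part is
`UnitaryModel.nReTr` (`ntr_re`). [cite: Balaban1985Averaging, (17) p.20] -/
def ntr (X : Matrix n n ℂ) : ℂ := X.trace / Fintype.card n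

/-- `Re tr X = nReTr X`. [folklore] -/
lemma ntr_re (X : Matrix n n ℂ) : (ntr X).re = nReTr X := by
  simp [ntr, nReTr, Complex.div_natCast_re]

/-- B7 (17): the scalar product `⟨X, Y⟩ = tr X*Y` on `M_N(ℂ)`. [cite: Balaban1985Averaging, (17) p.20] -/
def nhsInner (X Y : Matrix n n ℂ) : ℂ := ntr (Xᴴ * Y)

/-- B7 p. 21: `‖X‖² = tr X*X = (1/N) Σ_ij |X_ij|²`, the square of the `L²` norm of a matrix (normalized Hilbert–Schmidt norm).
[cite: Balaban1985Averaging, (17) p.20] -/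
def nhsNormSq (X : Matrix n n ℂ) : ℝ := (∑ i, ∑ j, ‖X i j‖ ^ 2) / Fintype.card n

/-- B7 p. 21: the `L²` norm `‖X‖ = (tr X*X)^{1/2}` of a matrix. [cite: Balaban1985Averaging, (17) p.20] -/
def nhsNorm (X : Matrix n n ℂ) : ℝ := Real.sqrt (nhsNormSq X)

/-- `Tr X*X = Σ_ij |X_ij|²` (unnormalized trace, as a complex number). [folklore] -/
lemma trace_conjTranspose_mul_self (X : Matrix n n ℂ) :
    (Xᴴ * X).trace = ((∑ i, ∑ j, ‖X i j‖ ^ 2 : ℝ) : ℂ) := by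
  simp only [Matrix.trace, Matrix.diag_apply, Matrix.mul_apply, Matrix.conjTranspose_apply,
    Complex.star_def, Complex.conj_mul', Complex.ofReal_sum, Complex.ofReal_pow]
  rw [Finset.sum_comm]

/-- `Σ_ij |X_ij|² = Re Tr X*X`. [folklore] -/
lemma sum_norm_sq_eq_re_trace (X : Matrix n n ℂ) : ∑ i, ∑ j, ‖X i j‖ ^ 2 = (Xᴴ * X).trace.re := by
  rw [trace_conjTranspose_mul_self, Complex.ofReal_re]

/-- B7 p. 21: `⟨X, X⟩ = tr X*X = ‖X‖²`. [cite: Balaban1985Averaging, (17) p.20] -/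
lemma nhsInner_self (X : Matrix n n ℂ) : nhsInner X X = (nhsNormSq X : ℂ) := by
  simp [nhsInner, ntr, nhsNormSq, trace_conjTranspose_mul_self, Complex.ofReal_div]

/-- `0 ≤ ‖X‖²`. [folklore] -/
lemma nhsNormSq_nonneg (X : Matrix n n ℂ) : 0 ≤ nhsNormSq X :=
  div_nonneg (Finset.sum_nonneg fun _ _ => Finset.sum_nonneg fun _ _ => sq_nonneg _) (Nat.cast_nonneg _)

/-- `0 ≤ ‖X‖`. [folklore] -/
lemma nhsNorm_nonneg (X : Matrix n n ℂ) : 0 ≤ nhsNorm X := Real.sqrt_nonneg _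

/-- `‖X‖ ^ 2 = ‖X‖²`. [folklore] -/
lemma nhsNorm_sq (X : Matrix n n ℂ) : nhsNorm X ^ 2 = nhsNormSq X := Real.sq_sqrt (nhsNormSq_nonneg X)

/-- `N ‖X‖² = Σ_ij |X_ij|²` (the unnormalized Hilbert–Schmidt norm squared). [folklore] -/
lemma card_mul_nhsNormSq [Nonempty n] (X : Matrix n n ℂ) :
    (Fintype.card n : ℝ) * nhsNormSq X = ∑ i, ∑ j, ‖X i j‖ ^ 2 := by
  have h : (Fintype.card n : ℝ) ≠ 0 := Nat.cast_ne_zero.mpr Fintype.card_ne_zero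
  rw [nhsNormSq, mul_div_cancel₀ _ h]

/-- `‖Xᴴ‖² = ‖X‖²`. [folklore] -/
lemma nhsNormSq_conjTranspose (X : Matrix n n ℂ) : nhsNormSq Xᴴ = nhsNormSq X := by
  simp only [nhsNormSq, Matrix.conjTranspose_apply, norm_star]
  rw [Finset.sum_comm]

/-- `‖Xᴴ‖ = ‖X‖`. [folklore] -/
lemma nhsNorm_conjTranspose (X : Matrix n n ℂ) : nhsNorm Xᴴ = nhsNorm X := by
  rw [nhsNorm, nhsNorm, nhsNormSq_conjTranspose]

end Trace

section OpNorm

variable {n : Type*} [Fintype n] [DecidableEq n]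

/-- `tr 1 = 1` (B12 (0.2)). [cite: Balaban1987RG1, (0.2) p.252] -/
lemma ntr_one [Nonempty n] : ntr (1 : Matrix n n ℂ) = 1 := by
  have h : (Fintype.card n : ℂ) ≠ 0 := Nat.cast_ne_zero.mpr Fintype.card_ne_zero
  simp [ntr, Matrix.trace_one, h]

/-! ## 2. The operator norm — B7 (19) p. 21 -/

/-- B7 (19): `|X| = sup {|Xψ| : ψ ∈ ℂᴺ, |ψ| = 1}`. In the tree `|X|` is Mathlib's `L²`-operator norm `‖X‖`, which is BY DEFINITION the
operator norm of the continuous linear map `ψ ↦ Xψ` of `EuclideanSpace ℂ n = ℂᴺ` (`|ψ|² = Σ_j |ψ_j|²`). [cite: Balaban1985Averaging, (19) p.21] -/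
lemma opNorm_eq (X : Matrix n n ℂ) : ‖X‖ = ‖Matrix.toEuclideanCLM (n := n) (𝕜 := ℂ) X‖ :=
  Matrix.cstar_norm_def X

/-- `|Xψ| ≤ |X| |ψ|`. [cite: Balaban1985Averaging, (19) p.21] -/
lemma norm_apply_le_opNorm_mul (X : Matrix n n ℂ) (ψ : EuclideanSpace ℂ n) :
    ‖Matrix.toEuclideanCLM (n := n) (𝕜 := ℂ) X ψ‖ ≤ ‖X‖ * ‖ψ‖ := by
  rw [opNorm_eq]
  exact ContinuousLinearMap.le_opNorm _ _

/-- `|X|` is the least `M ≥ 0` with `|Xψ| ≤ M |ψ|` for all `ψ` (the `sup` of (19)). [cite: Balaban1985Averaging, (19) p.21] -/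
lemma opNorm_le_of_bound (X : Matrix n n ℂ) {M : ℝ} (hM : 0 ≤ M)
    (h : ∀ ψ : EuclideanSpace ℂ n, ‖Matrix.toEuclideanCLM (n := n) (𝕜 := ℂ) X ψ‖ ≤ M * ‖ψ‖) : ‖X‖ ≤ M := by
  rw [opNorm_eq]
  exact ContinuousLinearMap.opNorm_le_bound _ hM h

/-- Column `ℓ²` norms are bounded by the operator norm: `Σ_i |X_ij|² ≤ |X|²` (the column is `X e_j`, `|e_j| = 1`); the entry bound
`|X_ij| ≤ |X|` is the tree's `Literature.Computability.QuantumComplexity.SolovayKitaev.norm_apply_le_norm`. [folklore] -/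
lemma sum_norm_sq_col_le_opNorm_sq (X : Matrix n n ℂ) (j : n) : ∑ i, ‖X i j‖ ^ 2 ≤ ‖X‖ ^ 2 := by
  have h := Matrix.l2_opNorm_mulVec X (EuclideanSpace.single j (1 : ℂ))
  rw [PiLp.norm_single, norm_one, mul_one] at h
  have hcol : ∑ i, ‖X i j‖ ^ 2 =
      ‖(EuclideanSpace.equiv n ℂ).symm (X *ᵥ ⇑(EuclideanSpace.single j (1 : ℂ)))‖ ^ 2 := by
    rw [EuclideanSpace.norm_sq_eq]
    refine Finset.sum_congr rfl fun i _ => ?_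
    simp
  rw [hcol]
  exact pow_le_pow_left₀ (norm_nonneg _) h 2

/-- `|X (Y e_j)|² ≤ |X|² |Y e_j|²`: the `j`-th column of `XY` against the `j`-th column of `Y`. [folklore] -/
lemma sum_norm_sq_mul_col_le (X Y : Matrix n n ℂ) (j : n) :
    ∑ i, ‖(X * Y) i j‖ ^ 2 ≤ ‖X‖ ^ 2 * ∑ i, ‖Y i j‖ ^ 2 := by
  set y : EuclideanSpace ℂ n := (EuclideanSpace.equiv n ℂ).symm (fun i => Y i j) with hy
  have h := Matrix.l2_opNorm_mulVec X y
  have hcol : ∑ i, ‖(X * Y) i j‖ ^ 2 = ‖(EuclideanSpace.equiv n ℂ).symm (X *ᵥ ⇑y)‖ ^ 2 := by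
    rw [EuclideanSpace.norm_sq_eq]
    refine Finset.sum_congr rfl fun i _ => ?_
    simp [hy, Matrix.mul_apply, Matrix.mulVec, dotProduct]
  have hy2 : ‖y‖ ^ 2 = ∑ i, ‖Y i j‖ ^ 2 := by
    rw [EuclideanSpace.norm_sq_eq]
    simp [hy]
  rw [hcol, ← hy2, ← mul_pow]
  exact pow_le_pow_left₀ (norm_nonneg _) h 2

/-! ## 3. The inequalities (20) — B7 p. 21 -/

/-- B7 (20), 1st inequality: `|tr X| ≤ |X|`. [cite: Balaban1985Averaging, (20) p.21] -/
theorem norm_ntr_le_opNorm (X : Matrix n n ℂ) : ‖ntr X‖ ≤ ‖X‖ := by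
  rcases isEmpty_or_nonempty n with hn | hn
  · have : ntr X = 0 := by simp [ntr, Matrix.trace]
    rw [this, norm_zero]
    exact norm_nonneg _
  have hc : (0 : ℝ) < Fintype.card n := Nat.cast_pos.mpr Fintype.card_pos
  have hent : ∀ i, ‖X i i‖ ≤ ‖X‖ := fun i => by
    have h : ‖X i i‖ ^ 2 ≤ ‖X‖ ^ 2 :=
      (Finset.single_le_sum (f := fun k => ‖X k i‖ ^ 2) (fun _ _ => sq_nonneg _)
        (Finset.mem_univ i)).trans (sum_norm_sq_col_le_opNorm_sq X i)
    exact (pow_le_pow_iff_left₀ (norm_nonneg _) (norm_nonneg _) two_ne_zero).1 h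
  rw [ntr, norm_div, Complex.norm_natCast, div_le_iff₀ hc]
  calc ‖X.trace‖ = ‖∑ i, X i i‖ := by simp [Matrix.trace]
    _ ≤ ∑ i, ‖X i i‖ := norm_sum_le _ _
    _ ≤ ∑ _i : n, ‖X‖ := Finset.sum_le_sum fun i _ => hent i
    _ = ‖X‖ * Fintype.card n := by simp [mul_comm]

/-- B7 (20), 1st inequality, real part: `|Re tr X| ≤ |X|`. [cite: Balaban1985Averaging, (20) p.21] -/
theorem abs_nReTr_le_opNorm (X : Matrix n n ℂ) : |nReTr X| ≤ ‖X‖ := by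
  rw [← ntr_re]
  exact (Complex.abs_re_le_norm _).trans (norm_ntr_le_opNorm X)

/-- B7 (20), 2nd inequality, squared: `‖X‖² ≤ |X|²` (average of the column bounds). [cite: Balaban1985Averaging, (20) p.21] -/
theorem nhsNormSq_le_opNorm_sq (X : Matrix n n ℂ) : nhsNormSq X ≤ ‖X‖ ^ 2 := by
  rcases isEmpty_or_nonempty n with hn | hn
  · have : nhsNormSq X = 0 := by simp [nhsNormSq]
    rw [this]
    exact sq_nonneg _
  have hc : (0 : ℝ) < Fintype.card n := Nat.cast_pos.mpr Fintype.card_pos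
  rw [nhsNormSq, div_le_iff₀ hc]
  calc ∑ i, ∑ j, ‖X i j‖ ^ 2 = ∑ j, ∑ i, ‖X i j‖ ^ 2 := Finset.sum_comm
    _ ≤ ∑ _j : n, ‖X‖ ^ 2 := Finset.sum_le_sum fun j _ => sum_norm_sq_col_le_opNorm_sq X j
    _ = ‖X‖ ^ 2 * Fintype.card n := by simp [mul_comm]

/-- B7 (20), 2nd inequality: `‖X‖ ≤ |X|`. [cite: Balaban1985Averaging, (20) p.21] -/
theorem nhsNorm_le_opNorm (X : Matrix n n ℂ) : nhsNorm X ≤ ‖X‖ :=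
  calc nhsNorm X = Real.sqrt (nhsNormSq X) := rfl
    _ ≤ Real.sqrt (‖X‖ ^ 2) := Real.sqrt_le_sqrt (nhsNormSq_le_opNorm_sq X)
    _ = ‖X‖ := Real.sqrt_sq (norm_nonneg _)

/-- `|X|² ≤ Σ_ij |X_ij|²` (operator norm ≤ unnormalized Hilbert–Schmidt norm; row-wise Cauchy–Schwarz). [folklore] -/
theorem opNorm_sq_le_sum_norm_sq (X : Matrix n n ℂ) : ‖X‖ ^ 2 ≤ ∑ i, ∑ j, ‖X i j‖ ^ 2 := by
  set S : ℝ := ∑ i, ∑ j, ‖X i j‖ ^ 2 with hS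
  have hS0 : 0 ≤ S := Finset.sum_nonneg fun i _ => Finset.sum_nonneg fun j _ => sq_nonneg _
  have hb : ‖X‖ ≤ Real.sqrt S := by
    refine opNorm_le_of_bound X (Real.sqrt_nonneg S) fun x => ?_
    rw [← Real.sqrt_sq (norm_nonneg (Matrix.toEuclideanCLM (n := n) (𝕜 := ℂ) X x)),
      ← Real.sqrt_sq (norm_nonneg x), ← Real.sqrt_mul hS0]
    refine Real.sqrt_le_sqrt ?_
    rw [EuclideanSpace.norm_sq_eq, EuclideanSpace.norm_sq_eq, hS, Finset.sum_mul]
    refine Finset.sum_le_sum fun i _ => ?_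
    have hi : (Matrix.toEuclideanCLM (n := n) (𝕜 := ℂ) X x) i = ∑ j, X i j * x j := by
      rw [Matrix.ofLp_toEuclideanCLM]
      rfl
    rw [hi]
    have hsum : ‖∑ j, X i j * x j‖ ≤ ∑ j, ‖X i j‖ * ‖x j‖ :=
      (norm_sum_le _ _).trans_eq (Finset.sum_congr rfl fun j _ => norm_mul _ _)
    calc ‖∑ j, X i j * x j‖ ^ 2 ≤ (∑ j, ‖X i j‖ * ‖x j‖) ^ 2 := by
          gcongr
      _ ≤ (∑ j, ‖X i j‖ ^ 2) * ∑ j, ‖x j‖ ^ 2 := Finset.sum_mul_sq_le_sq_mul_sq _ _ _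
  calc ‖X‖ ^ 2 ≤ Real.sqrt S ^ 2 := by gcongr
    _ = S := Real.sq_sqrt hS0

/-- B7 (20), 3rd inequality, squared: `|X|² ≤ N ‖X‖²`. [cite: Balaban1985Averaging, (20) p.21] -/
theorem opNorm_sq_le_card_mul_nhsNormSq (X : Matrix n n ℂ) : ‖X‖ ^ 2 ≤ Fintype.card n * nhsNormSq X := by
  rcases isEmpty_or_nonempty n with hn | hn
  · have hX : X = 0 := Subsingleton.elim _ _
    simp [hX, nhsNormSq]
  rw [card_mul_nhsNormSq]
  exact opNorm_sq_le_sum_norm_sq X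

/-- B7 (20), 3rd inequality: `|X| ≤ √N ‖X‖`. [cite: Balaban1985Averaging, (20) p.21] -/
theorem opNorm_le_sqrt_card_mul_nhsNorm (X : Matrix n n ℂ) : ‖X‖ ≤ Real.sqrt (Fintype.card n) * nhsNorm X :=
  calc ‖X‖ = Real.sqrt (‖X‖ ^ 2) := (Real.sqrt_sq (norm_nonneg _)).symm
    _ ≤ Real.sqrt (Fintype.card n * nhsNormSq X) := Real.sqrt_le_sqrt (opNorm_sq_le_card_mul_nhsNormSq X)
    _ = Real.sqrt (Fintype.card n) * nhsNorm X := by rw [Real.sqrt_mul (Nat.cast_nonneg _), nhsNorm]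

/-- B7 (20), 4th inequality: `|XY| ≤ |X| |Y|` (Mathlib `Matrix.l2_opNorm_mul`). [cite: Balaban1985Averaging, (20) p.21] -/
theorem opNorm_mul_le (X Y : Matrix n n ℂ) : ‖X * Y‖ ≤ ‖X‖ * ‖Y‖ := Matrix.l2_opNorm_mul X Y

/-- `‖XY‖² ≤ |X|² ‖Y‖²`. [folklore] -/
theorem nhsNormSq_mul_le (X Y : Matrix n n ℂ) : nhsNormSq (X * Y) ≤ ‖X‖ ^ 2 * nhsNormSq Y := by
  unfold nhsNormSq
  rw [← mul_div_assoc]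
  refine div_le_div_of_nonneg_right ?_ (Nat.cast_nonneg _)
  calc ∑ i, ∑ j, ‖(X * Y) i j‖ ^ 2 = ∑ j, ∑ i, ‖(X * Y) i j‖ ^ 2 := Finset.sum_comm
    _ ≤ ∑ j, ‖X‖ ^ 2 * ∑ i, ‖Y i j‖ ^ 2 := Finset.sum_le_sum fun j _ => sum_norm_sq_mul_col_le X Y j
    _ = ‖X‖ ^ 2 * ∑ i, ∑ j, ‖Y i j‖ ^ 2 := by rw [← Finset.mul_sum, Finset.sum_comm]

/-- The CORRECT mixed form of B7 (20), 5th inequality: `‖XY‖ ≤ |X| ‖Y‖`. [cite: Balaban1985Averaging, (20) p.21] -/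
theorem nhsNorm_mul_le_opNorm_mul_nhsNorm (X Y : Matrix n n ℂ) : nhsNorm (X * Y) ≤ ‖X‖ * nhsNorm Y :=
  calc nhsNorm (X * Y) = Real.sqrt (nhsNormSq (X * Y)) := rfl
    _ ≤ Real.sqrt (‖X‖ ^ 2 * nhsNormSq Y) := Real.sqrt_le_sqrt (nhsNormSq_mul_le X Y)
    _ = ‖X‖ * nhsNorm Y := by rw [Real.sqrt_mul (sq_nonneg _), Real.sqrt_sq (norm_nonneg _), nhsNorm]

/-- The CORRECT mixed form of B7 (20), 5th inequality, on the other side: `‖XY‖ ≤ ‖X‖ |Y|`. [cite: Balaban1985Averaging, (20) p.21] -/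
theorem nhsNorm_mul_le_nhsNorm_mul_opNorm (X Y : Matrix n n ℂ) : nhsNorm (X * Y) ≤ nhsNorm X * ‖Y‖ := by
  rw [← nhsNorm_conjTranspose, Matrix.conjTranspose_mul, ← nhsNorm_conjTranspose X,
    ← Matrix.l2_opNorm_conjTranspose Y, mul_comm]
  exact nhsNorm_mul_le_opNorm_mul_nhsNorm _ _

/-- The CORRECT `‖·‖`-only form of B7 (20), 5th inequality: `‖XY‖ ≤ √N ‖X‖ ‖Y‖` (the UNnormalized Hilbert–Schmidt norm
`√N ‖·‖` is submultiplicative). [cite: Balaban1985Averaging, (20) p.21] -/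
theorem nhsNorm_mul_le (X Y : Matrix n n ℂ) : nhsNorm (X * Y) ≤ Real.sqrt (Fintype.card n) * nhsNorm X * nhsNorm Y :=
  (nhsNorm_mul_le_opNorm_mul_nhsNorm X Y).trans
    (mul_le_mul_of_nonneg_right (opNorm_le_sqrt_card_mul_nhsNorm X) (nhsNorm_nonneg Y))

/-- FINDING (a): B7 (20), 5th inequality AS PRINTED, `‖XY‖ ≤ ‖X‖ ‖Y‖`, fails for the normalized norm of p. 21:
`X = Y = diag(1, 0) ∈ M₂(ℂ)` gives `‖X‖ ‖Y‖ = 1/2 < 1/√2 = ‖XY‖`. [cite: Balaban1985Averaging, (20) p.21] -/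
theorem nhsNorm_mul_not_submultiplicative :
    ∃ X Y : Matrix (Fin 2) (Fin 2) ℂ, nhsNorm X * nhsNorm Y < nhsNorm (X * Y) := by
  refine ⟨!![1, 0; 0, 0], !![1, 0; 0, 0], ?_⟩
  have hmul : (!![1, 0; 0, 0] : Matrix (Fin 2) (Fin 2) ℂ) * !![1, 0; 0, 0] = !![1, 0; 0, 0] := by
    ext i j
    fin_cases i <;> fin_cases j <;> simp [Matrix.mul_apply, Fin.sum_univ_two]
  have hsq : nhsNormSq (!![1, 0; 0, 0] : Matrix (Fin 2) (Fin 2) ℂ) = 1 / 2 := by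
    simp [nhsNormSq, Fin.sum_univ_two]
  rw [hmul, nhsNorm, hsq, Real.mul_self_sqrt (by norm_num)]
  exact (Real.lt_sqrt (by norm_num)).2 (by norm_num)

/-! ## 4. The identity behind B12 (0.14), and the operator-norm reading — p. 254 -/

/-- B12 (0.14): `‖U - 1‖² = tr (U - 1)*(U - 1) = 2 [1 - Re tr U]` for every unitary `U` (normalized trace and `L²` norm of B7).
[cite: Balaban1987RG1, (0.14) p.254] -/
theorem nhsNormSq_sub_one_of_mem_unitaryGroup [Nonempty n] {U : Matrix n n ℂ} (hU : U ∈ Matrix.unitaryGroup n ℂ) :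
    nhsNormSq (U - 1) = 2 * (1 - nReTr U) := by
  have hc : (Fintype.card n : ℝ) ≠ 0 := Nat.cast_ne_zero.mpr Fintype.card_ne_zero
  have hVV : Uᴴ * U = 1 := by
    have h := Matrix.mem_unitaryGroup_iff'.1 hU
    rwa [Matrix.star_eq_conjTranspose] at h
  have h : (U - 1)ᴴ * (U - 1) = 1 + 1 - U - Uᴴ := by
    rw [Matrix.conjTranspose_sub, Matrix.conjTranspose_one, sub_mul, mul_sub, mul_sub, one_mul, one_mul,
      mul_one, hVV]
    abel
  rw [nhsNormSq, sum_norm_sq_eq_re_trace, h, nReTr]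
  simp only [Matrix.trace_sub, Matrix.trace_add, Matrix.trace_one, Matrix.trace_conjTranspose, Complex.sub_re,
    Complex.add_re, Complex.natCast_re, Complex.star_def, Complex.conj_re]
  field_simp
  ring

/-- `2 [1 - Re tr U] ≤ |U - 1|²` for unitary `U` (operator norm; from `‖·‖ ≤ |·|`). [cite: Balaban1987RG1, (0.14) p.254] -/
theorem two_mul_one_sub_nReTr_le_opDist1_sq [Nonempty n] {U : Matrix n n ℂ} (hU : U ∈ Matrix.unitaryGroup n ℂ) :
    2 * (1 - nReTr U) ≤ opDist1 U ^ 2 := by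
  rw [← nhsNormSq_sub_one_of_mem_unitaryGroup hU, opDist1]
  exact nhsNormSq_le_opNorm_sq (U - 1)

/-- `|U - 1|² ≤ 2N [1 - Re tr U]` for unitary `U` (operator norm; from `|·| ≤ √N ‖·‖`). [cite: Balaban1987RG1, (0.14) p.254] -/
theorem opDist1_sq_le_card_mul [Nonempty n] {U : Matrix n n ℂ} (hU : U ∈ Matrix.unitaryGroup n ℂ) :
    opDist1 U ^ 2 ≤ Fintype.card n * (2 * (1 - nReTr U)) := by
  rw [← nhsNormSq_sub_one_of_mem_unitaryGroup hU, opDist1]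
  exact opNorm_sq_le_card_mul_nhsNormSq (U - 1)

/-- Cayley–Hamilton for `2 × 2` matrices: `A² - (Tr A) A + (det A) 1 = 0`. [folklore] -/
lemma cayleyHamilton_fin_two {R : Type*} [CommRing R] (A : Matrix (Fin 2) (Fin 2) R) :
    A * A - A.trace • A + A.det • (1 : Matrix (Fin 2) (Fin 2) R) = 0 := by
  ext i j
  fin_cases i <;> fin_cases j <;>
    simp [Matrix.mul_apply, Fin.sum_univ_two, Matrix.trace_fin_two, Matrix.det_fin_two] <;> ring

/-- For `U ∈ SU(2)`: `U + U* = (Tr U) 1` (Cayley–Hamilton with `det U = 1`, `U* U = 1`). [folklore] -/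
lemma add_conjTranspose_of_mem_specialUnitaryGroup_two {U : Matrix (Fin 2) (Fin 2) ℂ}
    (hU : U ∈ Matrix.specialUnitaryGroup (Fin 2) ℂ) : U + Uᴴ = U.trace • (1 : Matrix (Fin 2) (Fin 2) ℂ) := by
  obtain ⟨hUu, hdet⟩ := Matrix.mem_specialUnitaryGroup_iff.1 hU
  have hVV : Uᴴ * U = 1 := by
    have h := Matrix.mem_unitaryGroup_iff'.1 hUu
    rwa [Matrix.star_eq_conjTranspose] at h
  have hCH := cayleyHamilton_fin_two U
  rw [hdet, one_smul] at hCH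
  have h2 : Uᴴ * (U * U - U.trace • U + 1) = 0 := by rw [hCH, mul_zero]
  rw [mul_add, mul_sub, ← mul_assoc, hVV, one_mul, Matrix.mul_smul, hVV, mul_one, sub_add_eq_add_sub,
    sub_eq_zero] at h2
  exact h2

/-- FINDING (b), positive half: on `SU(2)` the identity (0.14) ALSO holds with the operator norm,
`|U - 1|² = 2 [1 - Re tr U]` (`(U - 1)*(U - 1) = (2 - Tr U) 1` by Cayley–Hamilton). [cite: Balaban1987RG1, (0.14) p.254] -/
theorem opDist1_sq_eq_of_mem_specialUnitaryGroup_two {U : Matrix (Fin 2) (Fin 2) ℂ}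
    (hU : U ∈ Matrix.specialUnitaryGroup (Fin 2) ℂ) : opDist1 U ^ 2 = 2 * (1 - nReTr U) := by
  obtain ⟨hUu, -⟩ := Matrix.mem_specialUnitaryGroup_iff.1 hU
  have hVV : Uᴴ * U = 1 := by
    have h := Matrix.mem_unitaryGroup_iff'.1 hUu
    rwa [Matrix.star_eq_conjTranspose] at h
  have hsum := add_conjTranspose_of_mem_specialUnitaryGroup_two hU
  have htr_im : U.trace.im = 0 := by
    have h := congrArg (fun M : Matrix (Fin 2) (Fin 2) ℂ => (Matrix.trace M).im) hsum
    simp only [Matrix.trace_add, Matrix.trace_conjTranspose, Matrix.trace_smul, Matrix.trace_one,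
      Fintype.card_fin, Nat.cast_ofNat, smul_eq_mul, Complex.add_im, Complex.star_def, Complex.conj_im,
      Complex.mul_im, Complex.re_ofNat, Complex.im_ofNat] at h
    linarith
  have hprod : (U - 1)ᴴ * (U - 1) = ((2 : ℂ) - U.trace) • (1 : Matrix (Fin 2) (Fin 2) ℂ) := by
    rw [Matrix.conjTranspose_sub, Matrix.conjTranspose_one, sub_mul, mul_sub, mul_sub, one_mul, one_mul,
      mul_one, hVV, sub_smul, ← hsum, two_smul]
    abel
  have hnorm : opDist1 U ^ 2 = ‖(2 : ℂ) - U.trace‖ := by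
    rw [opDist1, sq, ← Matrix.l2_opNorm_conjTranspose_mul_self, hprod, norm_smul, norm_one, mul_one]
  have hre : U.trace.re ≤ 2 := by
    have h := nReTr_le_one hUu
    simp only [nReTr, Fintype.card_fin, Nat.cast_ofNat] at h
    linarith
  have h2 : (2 : ℂ) - U.trace = ((2 - U.trace.re : ℝ) : ℂ) := by
    apply Complex.ext <;> simp [htr_im]
  rw [hnorm, h2, Complex.norm_real, Real.norm_of_nonneg (by linarith), nReTr, Fintype.card_fin]
  push_cast
  ring

/-- FINDING (b), negative half on `U(2)`: `U = diag(-1, 1)` is unitary with `|U - 1|² = 4 ≠ 2 = 2 [1 - Re tr U]`;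
(0.14) is not an operator-norm identity. [cite: Balaban1987RG1, (0.14) p.254] -/
theorem exists_unitaryGroup_two_opDist1_sq_ne :
    ∃ U ∈ Matrix.unitaryGroup (Fin 2) ℂ, opDist1 U ^ 2 ≠ 2 * (1 - nReTr U) := by
  refine ⟨Matrix.diagonal ![-1, 1], ?_, ?_⟩
  · rw [Matrix.mem_unitaryGroup_iff]
    ext i j
    fin_cases i <;> fin_cases j <;> simp [Matrix.mul_apply, Matrix.diagonal_apply]
  · have htr : nReTr (Matrix.diagonal ![-1, 1] : Matrix (Fin 2) (Fin 2) ℂ) = 0 := by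
      simp [nReTr, Matrix.trace, Fin.sum_univ_two]
    have hsub : (Matrix.diagonal ![-1, 1] : Matrix (Fin 2) (Fin 2) ℂ) - 1 = Matrix.diagonal ![-2, 0] := by
      ext i j
      fin_cases i <;> fin_cases j <;> norm_num
    have hge : 2 ≤ opDist1 (Matrix.diagonal ![-1, 1] : Matrix (Fin 2) (Fin 2) ℂ) := by
      rw [opDist1, hsub, Matrix.l2_opNorm_diagonal]
      refine le_trans ?_ (norm_le_pi_norm (![-2, 0] : Fin 2 → ℂ) 0)
      simp
    intro h
    rw [htr] at h
    nlinarith [hge]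

/-- FINDING (b), negative half on `SU(3)`: `U = diag(-1, -1, 1) ∈ SU(3)` has `|U - 1|² = 4 ≠ 8/3 = 2 [1 - Re tr U]`.
[cite: Balaban1987RG1, (0.14) p.254] -/
theorem exists_specialUnitaryGroup_three_opDist1_sq_ne :
    ∃ U ∈ Matrix.specialUnitaryGroup (Fin 3) ℂ, opDist1 U ^ 2 ≠ 2 * (1 - nReTr U) := by
  refine ⟨Matrix.diagonal ![-1, -1, 1], ?_, ?_⟩
  · rw [Matrix.mem_specialUnitaryGroup_iff, Matrix.mem_unitaryGroup_iff]
    refine ⟨?_, ?_⟩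
    · ext i j
      fin_cases i <;> fin_cases j <;> simp [Matrix.mul_apply, Matrix.diagonal_apply]
    · simp [Matrix.det_diagonal, Fin.prod_univ_three]
  · have htr : nReTr (Matrix.diagonal ![-1, -1, 1] : Matrix (Fin 3) (Fin 3) ℂ) = -1 / 3 := by
      simp [nReTr, Matrix.trace, Fin.sum_univ_three]
    have hsub : (Matrix.diagonal ![-1, -1, 1] : Matrix (Fin 3) (Fin 3) ℂ) - 1 = Matrix.diagonal ![-2, -2, 0] := by
      ext i j
      fin_cases i <;> fin_cases j <;> norm_num
    have hge : 2 ≤ opDist1 (Matrix.diagonal ![-1, -1, 1] : Matrix (Fin 3) (Fin 3) ℂ) := by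
      rw [opDist1, hsub, Matrix.l2_opNorm_diagonal]
      refine le_trans ?_ (norm_le_pi_norm (![-2, -2, 0] : Fin 3 → ℂ) 0)
      simp
    intro h
    rw [htr] at h
    nlinarith [hge]

end OpNorm

end

end MatrixNorms

end Literature.MathematicalPhysics.QuantumFieldTheory.Balaban1983to89
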